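import Mathlib
import Literature.Analysis.UnboundedOperators.HeatExtensionDecay
import Literature.Analysis.UnboundedOperators.HeatKernelBoundedData

/-!
# Route `FilamentSkeletonRss` · crux `TransverseReductionRJ` (stmt-NavierStokesRegularity-21221) — line `kelvin_gate`,
# stub S2′ `EventualKelvinGate`: the caloric extension keeps the QUADRATIC weight of the Y-scale

Helper file (theorems only, `--supports stmt-NavierStokesRegularity-21221 --as helper`), Mathlib +
`Literature.Analysis.UnboundedOperators` only (no route vocabulary).  HONEST FRAMING: analysis bookkeeping
for a HYPOTHETICAL filament-type rotating-self-similar blow-up route; nothing here bears on Navier–Stokes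
regularity; no stub is proved here.

The Y-scale of the line (`Theorems.KelvinGate.YBound`) is the class of `C¹` fields `F` on `ℝ³` with
`(1 + |y|)² |F(y)| ≤ R`, `(1 + |y|)² |DF(y)| ≤ R`.  The free gate (the inverse of the linearised
profile operator `½ + ½ y·∇ − Δ + α𝓡₀` at the trivial base) is built from the caloric extension
`e^{sΔ} F = G_s ⋆ F` in similarity variables; this file supplies the two weighted smoothing estimates
that construction needs, for heat times `s > 0` (used with `s ≤ 2`):

* `sq_weight_heatExtension_le` — there is an absolute `C_G > 0` with
  `(1 + |x|)² ‖e^{sΔ} f (x)‖ ≤ C_G (1 + s^{3/2}) A` whenever `f : ℝ³ → F` is continuous with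
  `(1 + |y|)² ‖f y‖ ≤ A` (near field `|x| ≤ 2|x − y|`: `(1+|x|)² ≤ 4(1+|x−y|)²` and the kernel has
  mass one; far field: the Gaussian tail `G_s(y) ≤ (4πs)^{-3/2} e^{-|x|²/(16 s)}` on the ball
  `|y − x| < |x|/2`, and `u³ e^{-u} ≤ 6`) — the quadratic-weight twin of the cubic-weight lemma
  `Theorems.SlicedKelvinPlanarFluxAPriori.decay_weighted_heatExtension_le`;
* `sq_weight_fderiv_heatExtension_le` — the same for the GRADIENT, with the parabolic rate:
  `(1 + |x|)² ‖D(e^{sΔ} f)(x)‖ ≤ 2^{3/2} C_G s^{-1/2} (1 + (2s)^{3/2}) A`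
  (`‖∇G_s‖ ≤ 2^{3/2} s^{-1/2} G_{2s}` pointwise, `UnboundedOperators.norm_fderiv_heatKernel_le_heatKernel_two_mul`,
  then the first estimate for `e^{2sΔ}‖f‖`).
-/

set_option linter.dupNamespace false

noncomputable section

namespace Summit.NavierStokesRegularity.NavierStokesRegularity.Theorems.KelvinGate

open MeasureTheory Set Filter Topology Metric Real
open scoped ENNReal NNReal Convolution
open Literature.Analysis.UnboundedOperators

/-! ## The caloric extension keeps the quadratic weight -/

/-- **The caloric extension keeps the quadratic weight**: there is an absolute `C_G > 0` such that for every
continuous `f : ℝ³ → F` with `(1 + |y|)² ‖f y‖ ≤ A` and every `s > 0`,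
`(1 + |x|)² ‖e^{sΔ} f (x)‖ ≤ C_G (1 + s^{3/2}) A`. -/
theorem sq_weight_heatExtension_le :
    ∃ C_G : ℝ, 0 < C_G ∧ ∀ {F : Type} [NormedAddCommGroup F] [NormedSpace ℝ F]
      ⦃s : ℝ⦄, 0 < s → ∀ {f : EuclideanSpace ℝ (Fin 3) → F}, Continuous f → ∀ {A : ℝ},
      (∀ y, (1 + ‖y‖) ^ 2 * ‖f y‖ ≤ A) → ∀ x : EuclideanSpace ℝ (Fin 3),
        (1 + ‖x‖) ^ 2 * ‖heatExtension f s x‖ ≤ C_G * (1 + s ^ (3 / 2 : ℝ)) * A := by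
  -- the far-field constant
  set c₀ : ℝ := (4 * π) ^ (-(3 : ℝ) / 2) with hc₀
  have hc₀0 : 0 < c₀ := Real.rpow_pos_of_pos (by positivity) _
  set C_far : ℝ := (π * 4 / 3) * c₀ * 6 * 16 ^ 3 with hCfar
  have hCfar0 : 0 < C_far := by positivity
  refine ⟨4 + C_far, by positivity, ?_⟩
  intro F _ _ s hs f hf A hA x
  have hfin : (Module.finrank ℝ (EuclideanSpace ℝ (Fin 3)) : ℝ) = 3 := by
    rw [finrank_euclideanSpace_fin]; norm_num
  have hA0 : 0 ≤ A := by
    have h0 := hA 0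
    have h1 : 0 ≤ (1 + ‖(0 : EuclideanSpace ℝ (Fin 3))‖) ^ 2 * ‖f 0‖ := by positivity
    linarith
  -- `f` is bounded by `A`
  have hfA : ∀ y, ‖f y‖ ≤ A := fun y => by
    have h1 : 1 ≤ (1 + ‖y‖) ^ 2 := one_le_pow₀ (by linarith [norm_nonneg y])
    have := hA y
    nlinarith [norm_nonneg (f y)]
  have hGpos : ∀ y : EuclideanSpace ℝ (Fin 3), 0 < heatKernel s y := fun y => heatKernel_pos hs y
  have hint1 : Integrable (fun y : EuclideanSpace ℝ (Fin 3) => heatKernel s y * A) :=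
    (integrable_heatKernel_holds hs).mul_const A
  have hmass : ∫ y : EuclideanSpace ℝ (Fin 3), heatKernel s y = 1 := integral_heatKernel_eq_one_holds hs
  have hs32' : 0 ≤ s ^ (3 / 2 : ℝ) := Real.rpow_nonneg hs.le _
  rcases lt_or_ge ‖x‖ 1 with hx1 | hx1
  · -- `|x| < 1`
    have h1 : ‖heatExtension f s x‖ ≤ A := norm_heatExtension_le_of_bound hfA hs x
    have h2 : (1 + ‖x‖) ^ 2 ≤ 4 := by
      calc (1 + ‖x‖) ^ 2 ≤ 2 ^ 2 := pow_le_pow_left₀ (by positivity) (by linarith) 2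
        _ = 4 := by norm_num
    calc (1 + ‖x‖) ^ 2 * ‖heatExtension f s x‖ ≤ 4 * A :=
          mul_le_mul h2 h1 (norm_nonneg _) (by norm_num)
      _ ≤ (4 + C_far) * (1 + s ^ (3 / 2 : ℝ)) * A := by
          refine mul_le_mul_of_nonneg_right ?_ hA0
          nlinarith
  · -- `|x| ≥ 1`: split the integrand
    have hx0 : 0 < ‖x‖ := lt_of_lt_of_le one_pos hx1
    set ρ : ℝ := ‖x‖ / 2 with hρ
    have hρ0 : 0 < ρ := by positivity
    set Bx : Set (EuclideanSpace ℝ (Fin 3)) := ball x ρ with hBx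
    set σ : ℝ := s ^ (3 / 2 : ℝ) with hσ
    have hσ0 : 0 < σ := Real.rpow_pos_of_pos hs _
    set u : ℝ := ‖x‖ ^ 2 / (16 * s) with hu
    have hu0 : 0 < u := by positivity
    set g : ℝ := c₀ * σ⁻¹ * Real.exp (-u) with hg
    have hg0 : 0 ≤ g := by positivity
    -- the Gaussian normalisation in dimension three
    have hnorm : (4 * π * s) ^ (-(Module.finrank ℝ (EuclideanSpace ℝ (Fin 3)) : ℝ) / 2) =
        c₀ * σ⁻¹ := by
      rw [hfin, hc₀, hσ, ← Real.rpow_neg hs.le, Real.mul_rpow (x := 4 * π) (y := s) (by positivity) hs.le]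
      congr 1
      norm_num
    have hpt : ∀ y, (1 + ‖x‖) ^ 2 * ‖heatKernel s y • f (x - y)‖ ≤
        4 * (heatKernel s y * A) + Bx.indicator (fun _ => (1 + ‖x‖) ^ 2 * g * A) y := by
      intro y
      rw [norm_smul, Real.norm_of_nonneg (hGpos y).le]
      rcases le_or_gt ‖x‖ (2 * ‖x - y‖) with hnear | hfar
      · -- near field: `(1 + |x|)² ‖f(x - y)‖ ≤ 4 A`
        have h1 : (1 + ‖x‖) ^ 2 * ‖f (x - y)‖ ≤ 4 * A := by
          have h2 : (1 + ‖x‖) ^ 2 ≤ 4 * (1 + ‖x - y‖) ^ 2 := by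
            have h3 : 1 + ‖x‖ ≤ 2 * (1 + ‖x - y‖) := by linarith
            calc (1 + ‖x‖) ^ 2 ≤ (2 * (1 + ‖x - y‖)) ^ 2 := pow_le_pow_left₀ (by positivity) h3 2
              _ = 4 * (1 + ‖x - y‖) ^ 2 := by ring
          calc (1 + ‖x‖) ^ 2 * ‖f (x - y)‖ ≤ 4 * (1 + ‖x - y‖) ^ 2 * ‖f (x - y)‖ :=
                mul_le_mul_of_nonneg_right h2 (norm_nonneg _)
            _ = 4 * ((1 + ‖x - y‖) ^ 2 * ‖f (x - y)‖) := by ring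
            _ ≤ 4 * A := by linarith [hA (x - y)]
        calc (1 + ‖x‖) ^ 2 * (heatKernel s y * ‖f (x - y)‖)
            = heatKernel s y * ((1 + ‖x‖) ^ 2 * ‖f (x - y)‖) := by ring
          _ ≤ heatKernel s y * (4 * A) := mul_le_mul_of_nonneg_left h1 (hGpos y).le
          _ = 4 * (heatKernel s y * A) := by ring
          _ ≤ 4 * (heatKernel s y * A) + Bx.indicator (fun _ => (1 + ‖x‖) ^ 2 * g * A) y :=
              le_add_of_nonneg_right (indicator_nonneg (fun _ _ => by positivity) _)
      · -- far field: `y ∈ B(x, |x|/2)`, Gaussian tail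
        have hyB : y ∈ Bx := by
          rw [hBx, mem_ball, dist_eq_norm, norm_sub_rev, hρ]; linarith
        have hxy2 : ‖x‖ ≤ 2 * ‖y‖ := by
          have h' : ‖x‖ - ‖y‖ ≤ ‖x - y‖ := norm_sub_norm_le x y
          linarith
        have hG : heatKernel s y ≤ g := by
          have h := heatKernel_le_exp_of_norm_le_two_mul hs hxy2
          rw [hnorm] at h
          have hexp : Real.exp (-‖x‖ ^ 2 / (16 * s)) = Real.exp (-u) := by rw [hu, neg_div]
          rw [hexp] at h
          exact h
        have h1 : (1 + ‖x‖) ^ 2 * (heatKernel s y * ‖f (x - y)‖) ≤ (1 + ‖x‖) ^ 2 * g * A := by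
          calc (1 + ‖x‖) ^ 2 * (heatKernel s y * ‖f (x - y)‖)
              ≤ (1 + ‖x‖) ^ 2 * (g * A) := by
                refine mul_le_mul_of_nonneg_left ?_ (by positivity)
                exact mul_le_mul hG (hfA _) (norm_nonneg _) hg0
            _ = (1 + ‖x‖) ^ 2 * g * A := by ring
        calc (1 + ‖x‖) ^ 2 * (heatKernel s y * ‖f (x - y)‖)
            ≤ (1 + ‖x‖) ^ 2 * g * A := h1
          _ = Bx.indicator (fun _ => (1 + ‖x‖) ^ 2 * g * A) y := by rw [indicator_of_mem hyB]
          _ ≤ 4 * (heatKernel s y * A) + Bx.indicator (fun _ => (1 + ‖x‖) ^ 2 * g * A) y :=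
              le_add_of_nonneg_left (by have := hGpos y; positivity)
    -- integrate the domination
    have hind : Integrable (fun y => Bx.indicator (fun _ => (1 + ‖x‖) ^ 2 * g * A) y)
        (volume : Measure (EuclideanSpace ℝ (Fin 3))) :=
      (integrableOn_const (measure_ball_lt_top.ne)).integrable_indicator measurableSet_ball
    have hint2 : Integrable (fun y => 4 * (heatKernel s y * A) +
        Bx.indicator (fun _ => (1 + ‖x‖) ^ 2 * g * A) y) := (hint1.const_mul 4).add hind
    have hvolB : (volume : Measure (EuclideanSpace ℝ (Fin 3))).real Bx = ρ ^ 3 * (π * 4 / 3) := by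
      rw [measureReal_def, hBx, EuclideanSpace.volume_ball_fin_three, ENNReal.toReal_mul,
        ← ENNReal.ofReal_pow hρ0.le, ENNReal.toReal_ofReal (by positivity),
        ENNReal.toReal_ofReal (by positivity)]
    have hmain : (1 + ‖x‖) ^ 2 * ‖heatExtension f s x‖ ≤
        4 * A + (1 + ‖x‖) ^ 2 * g * A * (ρ ^ 3 * (π * 4 / 3)) := by
      rw [heatExtension_apply]
      calc (1 + ‖x‖) ^ 2 * ‖∫ y, heatKernel s y • f (x - y)‖
          ≤ (1 + ‖x‖) ^ 2 * ∫ y, ‖heatKernel s y • f (x - y)‖ :=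
            mul_le_mul_of_nonneg_left (norm_integral_le_integral_norm _) (by positivity)
        _ = ∫ y, (1 + ‖x‖) ^ 2 * ‖heatKernel s y • f (x - y)‖ := (integral_const_mul _ _).symm
        _ ≤ ∫ y, (4 * (heatKernel s y * A) + Bx.indicator (fun _ => (1 + ‖x‖) ^ 2 * g * A) y) :=
            integral_mono_of_nonneg (Eventually.of_forall fun y => by positivity) hint2
              (Eventually.of_forall hpt)
        _ = 4 * A + (1 + ‖x‖) ^ 2 * g * A * (ρ ^ 3 * (π * 4 / 3)) := by
            rw [integral_add (hint1.const_mul 4) hind, integral_const_mul, integral_mul_const, hmass,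
              one_mul, integral_indicator measurableSet_ball, setIntegral_const, hvolB, smul_eq_mul]
            ring
    -- the far-field term is at most `C_far σ A`
    have hfar : (1 + ‖x‖) ^ 2 * g * A * (ρ ^ 3 * (π * 4 / 3)) ≤ C_far * σ * A := by
      -- `σ² = s³` and `u³ = |x|⁶ / (16³ σ²)`
      have hσ2 : σ ^ 2 = s ^ 3 := by
        rw [hσ, ← Real.rpow_natCast, ← Real.rpow_mul hs.le]
        norm_num
      have hu3 : u ^ 3 = ‖x‖ ^ 6 / (16 ^ 3 * σ ^ 2) := by
        rw [hu, hσ2]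
        field_simp
      -- `e^{-u} ≤ 6 u⁻³`
      have hexp : Real.exp (-u) ≤ 6 * (16 ^ 3 * σ ^ 2) / ‖x‖ ^ 6 := by
        have h1 : Real.exp (-u) ≤ 6 / u ^ 3 := by
          rw [le_div_iff₀ (by positivity), mul_comm]
          have h := pow_mul_exp_neg_le_factorial hu0.le 3
          have h6 : ((Nat.factorial 3 : ℕ) : ℝ) = 6 := by norm_num [Nat.factorial]
          rwa [h6] at h
        rw [hu3] at h1
        refine h1.trans (le_of_eq ?_)
        field_simp
      have hkey : (1 + ‖x‖) ^ 2 * g * (ρ ^ 3 * (π * 4 / 3)) ≤ C_far * σ := by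
        have h1 : (1 + ‖x‖) ^ 2 * g * (ρ ^ 3 * (π * 4 / 3)) ≤
            (1 + ‖x‖) ^ 2 * (c₀ * σ⁻¹ * (6 * (16 ^ 3 * σ ^ 2) / ‖x‖ ^ 6)) * (ρ ^ 3 * (π * 4 / 3)) := by
          rw [hg]
          gcongr
        refine h1.trans ?_
        have h2 : (1 + ‖x‖) ^ 2 * (c₀ * σ⁻¹ * (6 * (16 ^ 3 * σ ^ 2) / ‖x‖ ^ 6)) * (ρ ^ 3 * (π * 4 / 3)) =
            C_far * σ * ((1 + ‖x‖) ^ 2 / (8 * ‖x‖ ^ 3)) := by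
          rw [hCfar, hρ]
          field_simp
          ring
        rw [h2]
        have h4 : (1 + ‖x‖) ^ 2 / (8 * ‖x‖ ^ 3) ≤ 1 := by
          rw [div_le_one (by positivity)]
          have h3 : (1 + ‖x‖) ^ 2 ≤ (2 * ‖x‖) ^ 2 := pow_le_pow_left₀ (by positivity) (by linarith) 2
          nlinarith
        calc C_far * σ * ((1 + ‖x‖) ^ 2 / (8 * ‖x‖ ^ 3))
            ≤ C_far * σ * 1 := mul_le_mul_of_nonneg_left h4 (by positivity)
          _ = C_far * σ := mul_one _
      calc (1 + ‖x‖) ^ 2 * g * A * (ρ ^ 3 * (π * 4 / 3))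
          = ((1 + ‖x‖) ^ 2 * g * (ρ ^ 3 * (π * 4 / 3))) * A := by ring
        _ ≤ (C_far * σ) * A := mul_le_mul_of_nonneg_right hkey hA0
        _ = C_far * σ * A := by ring
    calc (1 + ‖x‖) ^ 2 * ‖heatExtension f s x‖
        ≤ 4 * A + (1 + ‖x‖) ^ 2 * g * A * (ρ ^ 3 * (π * 4 / 3)) := hmain
      _ ≤ 4 * A + C_far * σ * A := by linarith
      _ ≤ (4 + C_far) * (1 + σ) * A := by nlinarith

/-! ## The gradient of the caloric extension in the quadratic weight -/

/-- Pointwise domination of the gradient by the scalar caloric extension of `‖f‖` at double time: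
`‖D(e^{sΔ} f)(x)‖ ≤ 2^{3/2} s^{-1/2} · e^{2sΔ}‖f‖ (x)` for bounded continuous `f : ℝ³ → F` (`F` complete),
from `‖∇G_s(y)‖ ≤ 2^{3/2} s^{-1/2} G_{2s}(y)`. -/
theorem norm_fderiv_heatExtension_le_heatExtension_norm {F : Type*} [NormedAddCommGroup F] [NormedSpace ℝ F]
    [CompleteSpace F] {f : EuclideanSpace ℝ (Fin 3) → F} (hf : Continuous f) {C : ℝ} (hC : ∀ z, ‖f z‖ ≤ C)
    {s : ℝ} (hs : 0 < s) (x : EuclideanSpace ℝ (Fin 3)) :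
    ‖fderiv ℝ (heatExtension f s) x‖ ≤
      (2 : ℝ) ^ ((3 : ℝ) / 2) * s ^ (-(1 / 2 : ℝ)) * heatExtension (fun z => ‖f z‖) (2 * s) x := by
  have hfin : (Module.finrank ℝ (EuclideanSpace ℝ (Fin 3)) : ℝ) = 3 := by
    rw [finrank_euclideanSpace_fin]; norm_num
  have hmem : MemLp f ∞ (volume : Measure (EuclideanSpace ℝ (Fin 3))) :=
    memLp_top_of_continuous_of_bound hf hC
  have h1 := norm_fderiv_heatExtension_le hmem le_top hs x
  rw [convolution_def] at h1
  simp only [ContinuousLinearMap.lsmul_apply, smul_eq_mul] at h1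
  have h2s : 0 < 2 * s := by positivity
  set c : ℝ := (2 : ℝ) ^ ((3 : ℝ) / 2) * s ^ (-(1 / 2 : ℝ)) with hc
  have hc0 : 0 ≤ c := by positivity
  -- integrability of the dominating integrand `c · G_{2s}(y) ‖f(x - y)‖`
  have hnc : Continuous fun z => ‖f z‖ := hf.norm
  have hnb : ∀ z, ‖(fun z => ‖f z‖) z‖ ≤ C := fun z => by simpa using hC z
  have hint : Integrable (fun y => c * (heatKernel (2 * s) y * ‖f (x - y)‖))
      (volume : Measure (EuclideanSpace ℝ (Fin 3))) := by
    have h := (integrable_heatKernel_smul_of_bound hnc hnb h2s x).const_mul c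
    simpa [smul_eq_mul] using h
  have hpt : ∀ y, ‖fderiv ℝ (heatKernel s) y‖ * ‖f (x - y)‖ ≤ c * (heatKernel (2 * s) y * ‖f (x - y)‖) := by
    intro y
    have h := norm_fderiv_heatKernel_le_heatKernel_two_mul hs y
    rw [hfin] at h
    calc ‖fderiv ℝ (heatKernel s) y‖ * ‖f (x - y)‖ ≤ (c * heatKernel (2 * s) y) * ‖f (x - y)‖ :=
          mul_le_mul_of_nonneg_right h (norm_nonneg _)
      _ = c * (heatKernel (2 * s) y * ‖f (x - y)‖) := by ring
  refine h1.trans ?_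
  calc ∫ y, ‖fderiv ℝ (heatKernel s) y‖ * ‖f (x - y)‖
      ≤ ∫ y, c * (heatKernel (2 * s) y * ‖f (x - y)‖) :=
        integral_mono_of_nonneg (Eventually.of_forall fun y => by positivity) hint (Eventually.of_forall hpt)
    _ = c * heatExtension (fun z => ‖f z‖) (2 * s) x := by
        rw [integral_const_mul, heatExtension_apply]
        simp only [smul_eq_mul]

/-- **The gradient of the caloric extension keeps the quadratic weight, at the parabolic rate**: with the
constant `C_G` of `sq_weight_heatExtension_le`, for every continuous `f : ℝ³ → F` (`F` complete) with
`(1 + |y|)² ‖f y‖ ≤ A` and every `s > 0`,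
`(1 + |x|)² ‖D(e^{sΔ} f)(x)‖ ≤ 2^{3/2} s^{-1/2} · C_G (1 + (2s)^{3/2}) A`. -/
theorem sq_weight_fderiv_heatExtension_le :
    ∃ C_G : ℝ, 0 < C_G ∧ (∀ {F : Type} [NormedAddCommGroup F] [NormedSpace ℝ F]
      ⦃s : ℝ⦄, 0 < s → ∀ {f : EuclideanSpace ℝ (Fin 3) → F}, Continuous f → ∀ {A : ℝ},
      (∀ y, (1 + ‖y‖) ^ 2 * ‖f y‖ ≤ A) → ∀ x : EuclideanSpace ℝ (Fin 3),
        (1 + ‖x‖) ^ 2 * ‖heatExtension f s x‖ ≤ C_G * (1 + s ^ (3 / 2 : ℝ)) * A) ∧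
      ∀ {F : Type} [NormedAddCommGroup F] [NormedSpace ℝ F] [CompleteSpace F]
      ⦃s : ℝ⦄, 0 < s → ∀ {f : EuclideanSpace ℝ (Fin 3) → F}, Continuous f → ∀ {A : ℝ},
      (∀ y, (1 + ‖y‖) ^ 2 * ‖f y‖ ≤ A) → ∀ x : EuclideanSpace ℝ (Fin 3),
        (1 + ‖x‖) ^ 2 * ‖fderiv ℝ (heatExtension f s) x‖ ≤
          (2 : ℝ) ^ ((3 : ℝ) / 2) * s ^ (-(1 / 2 : ℝ)) * (C_G * (1 + (2 * s) ^ (3 / 2 : ℝ)) * A) := by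
  obtain ⟨C_G, hC_G, hW⟩ := sq_weight_heatExtension_le
  refine ⟨C_G, hC_G, fun {F} _ _ => hW, ?_⟩
  intro F _ _ _ s hs f hf A hA x
  have hfA : ∀ y, ‖f y‖ ≤ A := fun y => by
    have h1 : 1 ≤ (1 + ‖y‖) ^ 2 := one_le_pow₀ (by linarith [norm_nonneg y])
    have := hA y
    nlinarith [norm_nonneg (f y)]
  have h1 := norm_fderiv_heatExtension_le_heatExtension_norm hf hfA hs x
  have h2s : 0 < 2 * s := by positivity
  -- the first estimate for the scalar datum `‖f‖`
  have hA' : ∀ y, (1 + ‖y‖) ^ 2 * ‖(fun z => ‖f z‖) y‖ ≤ A := fun y => by simpa using hA y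
  have h2 := hW h2s hf.norm hA' x
  have hc0 : 0 ≤ (2 : ℝ) ^ ((3 : ℝ) / 2) * s ^ (-(1 / 2 : ℝ)) := by positivity
  calc (1 + ‖x‖) ^ 2 * ‖fderiv ℝ (heatExtension f s) x‖
      ≤ (1 + ‖x‖) ^ 2 * ((2 : ℝ) ^ ((3 : ℝ) / 2) * s ^ (-(1 / 2 : ℝ)) *
          heatExtension (fun z => ‖f z‖) (2 * s) x) := mul_le_mul_of_nonneg_left h1 (by positivity)
    _ = (2 : ℝ) ^ ((3 : ℝ) / 2) * s ^ (-(1 / 2 : ℝ)) *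
          ((1 + ‖x‖) ^ 2 * heatExtension (fun z => ‖f z‖) (2 * s) x) := by ring
    _ ≤ (2 : ℝ) ^ ((3 : ℝ) / 2) * s ^ (-(1 / 2 : ℝ)) *
          ((1 + ‖x‖) ^ 2 * ‖heatExtension (fun z => ‖f z‖) (2 * s) x‖) := by
        refine mul_le_mul_of_nonneg_left (mul_le_mul_of_nonneg_left (Real.le_norm_self _) (by positivity)) hc0
    _ ≤ (2 : ℝ) ^ ((3 : ℝ) / 2) * s ^ (-(1 / 2 : ℝ)) * (C_G * (1 + (2 * s) ^ (3 / 2 : ℝ)) * A) :=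
        mul_le_mul_of_nonneg_left h2 hc0

end Summit.NavierStokesRegularity.NavierStokesRegularity.Theorems.KelvinGate

end
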